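import Literature.IUT.LogVolume.IdealArithmeticDivisors
import Literature.IUT.LogVolume.RArithmeticDivisorsPullback
import Literature.IUT.LogVolume.FakeAdeleIndex
import Mathlib.NumberTheory.RamificationInertia.Valuation
import HarnessLib

/-!
# Joshi, *Arithmetic Teichmüller spaces IV* [J-IV] §4.2, Lemma 4.1.4, §4.4 — relative ramification, the Tate divisor, and
# Proposition 4.4.4

Record file of the abc-iut cell, branch E «type Joshi's construction, test vs S» (rung LADDER-ABC:A2.E; seat abc-iut-E-t26,
slot T-26 of plan/E/ASSIGNMENTS.md; JOSHI-DAG nodes J4:Lem4.1.4, J4:Rmk4.4.1, J4:Def4.4.2, J4:Rmk4.4.3, J4:Prop4.4.4 and the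
un-numbered items §4.1.2 (6)–(9), §4.2 (relative notations), §4.4 set-up; companion of `Joshi/ATS4Differents.lean` (§4.1.1,
Prop. 4.1.1, Lem. 4.1.2, §4.2.1, §4.3, Prop. 4.3.5), independent of it). TAKES NO SIDE on [IUTchIII] Cor. 3.12, on Joshi's
claims, or on Mochizuki's reports on them; typed ≠ proved ≠ endorsed. Source: K. Joshi, *Construction of Arithmetic
Teichmuller Spaces IV: Proof of the abc-conjecture*, arXiv:2403.10430v2 (2024), UNREFEREED preprint («Preliminary version for
comments»), bib `Joshi2024ATS4`; locators «p.N l.a–b» = lines a–b of page file `pNNNN.txt` of the cell render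
`HOME/lit/renders/Joshi-arxiv-2403.10430/` (PDF page N).

## What is typed here, and how (plan/E/E-PLAN.md R6/R14: DATA as `structure`/`def`, ASSERTIONS as claim-`Prop`s tagged
## `@[claim "Joshi2024ATS4" "disputed"]`, never asserted; consequences of the typed signature PROVED; imports = Mathlib +
## `Literature.IUT.LogVolume` only)

* §4.2 (p.39 l.2–11 = p.40 l.27–34): `e_{w|v}`, `f_{w|v}` for a finite place `w` of `K` over `v = w|_F` are Mathlib's
  `Ideal.ramificationIdx'` / `Ideal.inertiaDeg'` at the tree's `finBelow` (`relRamIdx`, `relResDeg`); `log w = f_{w|v}·log v` is the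
  tree's `logNorm_eq_inertiaDeg_mul`; `f_w`, `e_w`, `log w = log(p^{f_w})` are the tree's `resDeg`, `ramIdx`, `logNorm_eq` — cited
  BY NAME. «Unramified / tamely ramified outside `S`» (`UnramifiedOutside`, `TamelyRamifiedOutside`) are the notions Lemma 4.1.4
  uses. The valuation identity of the proof of Prop. 4.4.4, «`ord_w(q_v) = e_{w|v}·ord_v(q_v)`» (p.41 l.39–42), is PROVED for every
  element (`ord_algebraMap`, Mathlib `valuation_liesOver`).
* §4.4 (p.40 l.23–p.42 l.70): the Tate divisor `𝔮_M = Σ_{w ∈ V^{odd,ss}_M} ord_w(q_w)·w` and the reduced Tate divisor `𝔣_M = Σ 1·w`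
  (Definition 4.4.2) are `ℝ`-arithmetic divisors (tree `ADivisor M`, [IUTchIV] Def. 1.9) over a signature `TateDivisorDatum M` =
  (the finite set `V^{odd,ss}_M`, the local heights `ord_w(q_w) ∈ ℕ_{>0}`, Remark 4.4.3); `log(𝔮_M)`, `log(𝔣_M)` are their normalized
  degrees (tree `ndeg`); (4.4.5) is PROVED (`logq_eq_sum`). The base-change relation of the §4.4 set-up and of the proof of
  Proposition 4.4.4 («`V^{odd,ss}_M` = inverse image of `V_{L_mod}`», «`q_w = q_v` is also the Tate parameter over `𝒪_{M_w}` …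
  `ord_w(q_w) = e_{w|v}·ord_v(q_v)`», p.40 l.35–40, p.41 l.32–42) is the claim-`Prop` `TateDivisorDatum.IsBaseChangeOf` (its
  valuation half PROVED for data read off actual elements: `isBaseChangeOf_of_tateParameters`); under it `𝔮_M` is the PULL-BACK
  of `𝔮_{L_mod}` (`tateDivisor_eq_pullback`, tree `ADivisor.pullback`) and **Proposition 4.4.4 `log(𝔮_M) = log(𝔮_{L_mod})` is
  PROVED** (`prop444`): the degree computation (4.4.5)–(4.4.9), which Joshi says is «asserted without proof in [Mochizuki,
  2021d]», is the tree's `ndeg_pullback` ([IUTchIV] Def. 1.9 (i), `RArithmeticDivisorsPullback.lean`).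
* §4.1.2 (6)–(9) and Lemma 4.1.4 (p.38 l.4–10, l.32–40): the tower `L_tpd → L → L′` over genuine number fields with the prime `ℓ`,
  `Supp(𝔮_{L_tpd})` and the torsion hypotheses (7)–(9) as OPAQUE `Prop` fields (`TowerDatum`; the torsion points of `C` are not
  objects here — merge-debt T-06/T-28); Lemma 4.1.4 (1)(2) = claim-`Prop`s `Lem414_1`, `Lem414_2`.

Deliberately NOT here: the elliptic curve, its reduction theory and Tate uniformisation (no Mathlib API over number fields; only
the orders `ord_w(q_w)` are carried; nearest cell objects `Literature.IUT.LogVolume.PilotData.qDivisor` — the q-pilot divisor of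
Dupuy–Hilado Def. 3.1.1 — and `EllPoint.localHeight`, [GenEll] Def. 3.3); §4.5–§4.6 (idelic Tate divisors, Theorem 4.6.1: slot
T-27 `Joshi/ATS4TateDivisors.lean`); any binding to the cell's frozen `Cor312*` / `Thm311*` interface (R14); any judgement.
-/

noncomputable section

open NumberField IsDedekindDomain Finset
open Literature.IUT.LogVolume

namespace Summit.ABC.IUTFork.Joshi.ATS4

/-! ## 1. §4.2: the relative invariants `e_{w|v}`, `f_{w|v}`; unramified / tamely ramified outside `S`; `ord_w = e_{w|v}·ord_v` -/

section Relative

variable (F K : Type*) [Field F] [NumberField F] [Field K] [NumberField K] [Algebra F K]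

/-- §4.2, p.39 l.10–11 (= p.40 l.33–34): «Let `e_{w|v}` be the relative ramification index of `M_w/L_{mod,v}`» — for a finite
place `w` of `K` over `v = w|_F` (tree `finBelow`), Mathlib's `e(w|v)` (the tree's `pullbackWeight` at `w`).
[claim: Joshi2024ATS4, status: disputed] -/
def relRamIdx (w : HeightOneSpectrum (𝓞 K)) : ℕ := (finBelow F K w).asIdeal.ramificationIdx' w.asIdeal

/-- §4.2, p.39 l.5–6: «`f_{w|v}` the relative residue field degree of `M_w/L_{mod,v}`» — Mathlib's `f(w|v)`; `log w = f_{w|v}·log v`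
is the tree's `logNorm_eq_inertiaDeg_mul`. [claim: Joshi2024ATS4, status: disputed] -/
def relResDeg (w : HeightOneSpectrum (𝓞 K)) : ℕ := (finBelow F K w).asIdeal.inertiaDeg' w.asIdeal

/-- `K/F` is UNRAMIFIED OUTSIDE `S ⊆ V^non_F`: `e_{w|v} = 1` for every finite place `w` of `K` with `v = w|_F ∉ S` (the notion
used in Lemma 4.1.4). [folklore] -/
def UnramifiedOutside (S : Set (HeightOneSpectrum (𝓞 F))) : Prop :=
  ∀ w : HeightOneSpectrum (𝓞 K), finBelow F K w ∉ S → relRamIdx F K w = 1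

/-- `K/F` is TAMELY RAMIFIED OUTSIDE `S`: the residue characteristic of `w` does not divide `e_{w|v}` whenever `v = w|_F ∉ S`
(the notion used in Lemma 4.1.4; cf. tree `Literature.IUT.LogVolume.IsTamelyRamified` for local fields). [folklore] -/
def TamelyRamifiedOutside (S : Set (HeightOneSpectrum (𝓞 F))) : Prop :=
  ∀ w : HeightOneSpectrum (𝓞 K), finBelow F K w ∉ S → ¬ residueChar K w ∣ relRamIdx F K w

variable {F K}

omit [NumberField F] [NumberField K] in
/-- Unramified places are tamely ramified. [folklore] -/
theorem tamelyRamifiedOutside_of_unramifiedOutside {S : Set (HeightOneSpectrum (𝓞 F))}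
    (h : UnramifiedOutside F K S) : TamelyRamifiedOutside F K S := fun w hw => by
  rw [h w hw]
  exact (residueChar_prime K w).not_dvd_one

omit [NumberField F] [NumberField K] in
/-- Monotonicity in the exceptional set. [folklore] -/
theorem UnramifiedOutside.mono {S T : Set (HeightOneSpectrum (𝓞 F))} (hST : S ⊆ T) (h : UnramifiedOutside F K S) :
    UnramifiedOutside F K T := fun w hw => h w fun hS => hw (hST hS)

/-- **§4.2 / proof of Prop. 4.4.4, p.41 l.32–42**: «If `q_v` is a Tate parameter of `C_{L_{mod},v}`, then for some `α` one has
`q_v = π_v^α` … `q_w = q_v` is also the Tate parameter over `𝒪_{M_w}`. Hence as `π_w = π_v^{e_{w|v}}` [sic] one sees that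
`ord_w(q_w) = ord_w(q_v) = e_{w|v}·ord_v(q_v)`» — the valuation-theoretic content, PROVED for any element: the normalised
valuation of `x ∈ F` at a place `w` of `K` over `v` is `e_{w|v}` times its valuation at `v` (Mathlib `valuation_liesOver`;
tree `ord`). [folklore] -/
theorem ord_algebraMap (w : HeightOneSpectrum (𝓞 K)) (x : F) :
    ord K w (algebraMap F K x) = (relRamIdx F K w : ℤ) * ord F (finBelow F K w) x := by
  rw [ord, ord, relRamIdx, ← IsDedekindDomain.HeightOneSpectrum.valuation_liesOver K (finBelow F K w) w x,
    WithZero.log_pow, nsmul_eq_mul, mul_neg]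

end Relative

/-! ## 2. §4.4: the Tate divisor, the reduced Tate divisor, and Proposition 4.4.4 -/

/-- **The Tate divisor datum of `C_M`** (§4.4, p.40 l.23–p.41 l.14): a number field `M` (genuine; in print `L′ ⊇ M ⊇ L_mod`
finite Galois, `C_M = C ×_L M`), the finite set `V^{odd,ss}_M` of finite places («the inverse image of the set of primes … of
`L_mod` (of odd residue characteristics by assumption) over which `C_{L_mod}` has semi-stable reduction», p.40 l.35–40 — see
`IsBaseChangeOf`; Remark 4.4.1, p.40 l.41–47: «since additive reduction is unstable under finite extensions and may become
multiplicative reduction [Silverman, 1985], some prime `w` of semi-stable reduction of `C_M` may lie over a prime `v ∉ V_{L_mod}`.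
Such a `w ∉ V^{odd,ss}_M`»), and for `w ∈ V^{odd,ss}_M` the order `ord_w(q_w) ≥ 1` of a Tate parameter `q_w` of `C_{M_w}` («well
defined up to multiplication by a local unit», Def. 4.4.2; Remark 4.4.3, p.41 l.15–16: «In [Mochizuki, 2010, Definition 3.3], the
number `ord_w(q_w)` is called the local height of the elliptic curve at `w`» — the cell's `EllPoint.localHeight`,
`Literature.IUT.LogVolume.Corollary22Statement`). SIGNATURE: only the orders are carried (the Tate curve is not an object here;
nearest cell object: `Literature.IUT.LogVolume.PilotData.qDivisor`, the q-pilot divisor of Dupuy–Hilado Def. 3.1.1).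
[claim: Joshi2024ATS4, status: disputed] -/
structure TateDivisorDatum (M : Type*) [Field M] [NumberField M] where
  /-- `V^{odd,ss}_M` -/
  V : Finset (HeightOneSpectrum (𝓞 M))
  /-- `ord_w(q_w)`, the local height at `w` (only used on `V`) -/
  ordq : HeightOneSpectrum (𝓞 M) → ℕ
  /-- a Tate parameter lies in the maximal ideal: `ord_w(q_w) ≥ 1` on `V` -/
  ordq_pos : ∀ w ∈ V, 0 < ordq w

namespace TateDivisorDatum

section OneField

variable {M : Type*} [Field M] [NumberField M] (𝔮 : TateDivisorDatum M)

/-- «of odd residue characteristics by assumption» (p.40 l.39; [J-III] §3 (6)). [claim: Joshi2024ATS4, status: disputed] -/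
def OddResidueChars : Prop := ∀ w ∈ 𝔮.V, Odd (residueChar M w)

/-- **Definition 4.4.2, the Tate divisor** (p.40 l.51–p.41 l.1): «The arithmetic divisor `𝔮_M = Σ_{w ∈ V^{odd,ss}_M} ord_w(q_w)·w`
will be called the Tate divisor of `C_M`». [claim: Joshi2024ATS4, status: disputed] -/
def tateDivisor : ADivisor M := ∑ w ∈ 𝔮.V, ADivisor.of (Sum.inr w) (𝔮.ordq w : ℝ)

/-- **Definition 4.4.2, the reduced Tate divisor** (p.41 l.2–7): «`𝔣_M = (𝔮_M)_red = Σ_{w ∈ V^{odd,ss}_M} 1·w` will be called the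
reduced Tate divisor of `C_M`» — the tree's reduced divisor on `V^{odd,ss}_M`. [claim: Joshi2024ATS4, status: disputed] -/
def reducedTateDivisor : ADivisor M := ADivisor.reduced 𝔮.V

/-- «`log(𝔮_M) = (1/[M:ℚ])·deg(𝔮_M)`» (p.41 l.9–10). [claim: Joshi2024ATS4, status: disputed] -/
def logq : ℝ := ndeg M 𝔮.tateDivisor

/-- «`log(𝔣_M) = (1/[M:ℚ])·deg(𝔣_M)`» (p.41 l.12–13). [claim: Joshi2024ATS4, status: disputed] -/
def logf : ℝ := ndeg M 𝔮.reducedTateDivisor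

open scoped Classical in
/-- Coefficients of the Tate divisor: `ord_w(q_w)` on `V^{odd,ss}_M`, `0` elsewhere. [folklore] -/
theorem tateDivisor_apply_inr (w : HeightOneSpectrum (𝓞 M)) :
    𝔮.tateDivisor (Sum.inr w) = if w ∈ 𝔮.V then (𝔮.ordq w : ℝ) else 0 := by
  rw [tateDivisor, Finsupp.finsetSum_apply]
  simp only [Finsupp.single_apply, Sum.inr.injEq]
  rw [Finset.sum_ite_eq' 𝔮.V w]

/-- The Tate divisor has no archimedean component. [folklore] -/
theorem tateDivisor_apply_inl (w : InfinitePlace M) : 𝔮.tateDivisor (Sum.inl w) = 0 := by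
  classical
  rw [tateDivisor, Finsupp.finsetSum_apply]
  exact Finset.sum_eq_zero fun v _ => by rw [Finsupp.single_apply, if_neg Sum.inr_ne_inl]

/-- The Tate divisor is effective. [folklore] -/
theorem tateDivisor_isEffective : 𝔮.tateDivisor.IsEffective := by
  classical
  rintro (w | w)
  · rw [tateDivisor_apply_inl]
  · rw [tateDivisor_apply_inr]; split_ifs <;> simp

open scoped Classical in
/-- `(𝔮_M)_red` is the tree's reduced divisor: coefficient `1` on `V^{odd,ss}_M = Supp(𝔮_M)`. [folklore] -/
theorem reducedTateDivisor_apply_inr (w : HeightOneSpectrum (𝓞 M)) :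
    𝔮.reducedTateDivisor (Sum.inr w) = if w ∈ 𝔮.V then 1 else 0 :=
  ADivisor.reduced_apply_inr 𝔮.V w

/-- The support of `𝔮_M` among the finite places is exactly `V^{odd,ss}_M` (as `ord_w(q_w) ≥ 1` there), so `𝔣_M` IS `(𝔮_M)_red`.
[folklore] -/
theorem tateDivisor_apply_inr_ne_zero_iff (w : HeightOneSpectrum (𝓞 M)) : 𝔮.tateDivisor (Sum.inr w) ≠ 0 ↔ w ∈ 𝔮.V := by
  classical
  rw [tateDivisor_apply_inr]
  split_ifs with h
  · simp only [ne_eq, Nat.cast_eq_zero, h, iff_true]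
    exact (𝔮.ordq_pos w h).ne'
  · simp [h]

/-- **(4.4.5)** (p.41 l.22–29): «`log(𝔮_M) = (1/[M:ℚ])·Σ_{w ∈ V^{odd,ss}_M} ord_w(q_w)·log w`». [folklore] -/
theorem logq_eq_sum : 𝔮.logq = (∑ w ∈ 𝔮.V, (𝔮.ordq w : ℝ) * logNorm M w) / Module.finrank ℚ M := by
  rw [logq, ndeg_apply, tateDivisor, map_sum]
  congr 1
  exact Finset.sum_congr rfl fun w _ => degF_of_inr M w _

/-- `log(𝔣_M) = (1/[M:ℚ])·Σ_{w ∈ V^{odd,ss}_M} log w`. [folklore] -/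
theorem logf_eq_sum : 𝔮.logf = (∑ w ∈ 𝔮.V, logNorm M w) / Module.finrank ℚ M := by
  rw [logf, ndeg_apply, reducedTateDivisor, ADivisor.degF_reduced_eq_sum]

/-- `log(𝔣_M) ≤ log(𝔮_M)` (coefficientwise `1 ≤ ord_w(q_w)`). [folklore] -/
theorem logf_le_logq : 𝔮.logf ≤ 𝔮.logq := by
  rw [logf_eq_sum, logq_eq_sum]
  refine div_le_div_of_nonneg_right (Finset.sum_le_sum fun w hw => ?_) (Nat.cast_nonneg _)
  have h1 : (1 : ℝ) ≤ 𝔮.ordq w := by exact_mod_cast 𝔮.ordq_pos w hw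
  nlinarith [logNorm_pos M w]

/-- `0 ≤ log(𝔣_M)`. [folklore] -/
theorem logf_nonneg : 0 ≤ 𝔮.logf := by
  rw [logf]; exact ndeg_nonneg M (ADivisor.reduced_isEffective 𝔮.V)

end OneField

section BaseChange

variable {Lmod M : Type*} [Field Lmod] [NumberField Lmod] [Field M] [NumberField M] [Algebra Lmod M]
  (𝔮M : TateDivisorDatum M) (𝔮 : TateDivisorDatum Lmod)

/-- **The base-change relation between the Tate divisor data of `C_M` and `C_{L_mod}`** for `M ⊇ L_mod` (the §4.4 set-up and
the elliptic-curve step of the proof of Prop. 4.4.4): (i) «Let `V^{odd,ss}_M` be the inverse image of the set of primes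
`V_{L_mod}` … over which `C_{L_mod}` has semi-stable reduction» (p.40 l.35–40); (ii) «`q_w = q_v` is also the Tate parameter over
`𝒪_{M_w}`. Hence … `ord_w(q_w) = ord_w(q_v) = e_{w|v}·ord_v(q_v)`» (p.41 l.32–42; stability of split multiplicative reduction
and of the Tate parameter under base change, [Silverman, 1985]). CLAIM about the elliptic curve, typed as a named `Prop` over
the two signatures (its valuation-theoretic half is `ord_algebraMap` / `isBaseChangeOf_of_tateParameters`); never asserted.
[claim: Joshi2024ATS4, status: disputed] -/
@[claim "Joshi2024ATS4" "disputed"]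
def IsBaseChangeOf : Prop :=
  (∀ w, w ∈ 𝔮M.V ↔ finBelow Lmod M w ∈ 𝔮.V) ∧
    ∀ w, finBelow Lmod M w ∈ 𝔮.V → 𝔮M.ordq w = relRamIdx Lmod M w * 𝔮.ordq (finBelow Lmod M w)

/-- **The proof's step p.41 l.32–42 in kernel form**: if the local heights of both data are read off ONE family of elements
`q_v ∈ L_mod` (`ord_v(q_v)` below, `ord_w(q_v)` above — «`q_w = q_v` is also the Tate parameter over `𝒪_{M_w}`») and
`V^{odd,ss}_M` is the fibre of `V^{odd,ss}_{L_mod}`, then the data are in base-change relation (by `ord_algebraMap`).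
[folklore] -/
theorem isBaseChangeOf_of_tateParameters (q : HeightOneSpectrum (𝓞 Lmod) → Lmod)
    (hV : ∀ w, w ∈ 𝔮M.V ↔ finBelow Lmod M w ∈ 𝔮.V)
    (hq : ∀ v ∈ 𝔮.V, (𝔮.ordq v : ℤ) = ord Lmod v (q v))
    (hqM : ∀ w, finBelow Lmod M w ∈ 𝔮.V → (𝔮M.ordq w : ℤ) = ord M w (algebraMap Lmod M (q (finBelow Lmod M w)))) :
    𝔮M.IsBaseChangeOf 𝔮 := by
  refine ⟨hV, fun w hw => ?_⟩
  have h := hqM w hw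
  rw [ord_algebraMap, ← hq _ hw, ← Nat.cast_mul, Nat.cast_inj] at h
  exact h

/-- Under the base-change relation the Tate divisor of `C_M` is the PULL-BACK ([IUTchIV] Def. 1.9 (i), tree
`ADivisor.pullback`: `v ↦ Σ_{w|v} e_{w|v}·w`) of the Tate divisor of `C_{L_mod}` — the content of (4.4.6). [folklore] -/
theorem tateDivisor_eq_pullback (h : 𝔮M.IsBaseChangeOf 𝔮) :
    𝔮M.tateDivisor = 𝔮.tateDivisor.pullback Lmod M := by
  classical
  ext (w | w)
  · rw [tateDivisor_apply_inl, ADivisor.pullback_apply]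
    change _ = _ * 𝔮.tateDivisor (Sum.inl (w.comap (algebraMap Lmod M)))
    rw [tateDivisor_apply_inl, mul_zero]
  · rw [tateDivisor_apply_inr, ADivisor.pullback_apply]
    change _ = (relRamIdx Lmod M w : ℝ) * 𝔮.tateDivisor (Sum.inr (finBelow Lmod M w))
    rw [tateDivisor_apply_inr]
    by_cases hv : finBelow Lmod M w ∈ 𝔮.V
    · rw [if_pos ((h.1 w).mpr hv), if_pos hv, h.2 w hv, Nat.cast_mul]
    · rw [if_neg (fun hw => hv ((h.1 w).mp hw)), if_neg hv, mul_zero]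

/-- **Proposition 4.4.4** (p.41 l.19–20): «If `L′ ⊇ M ⊇ L_mod` is a finite extension, then `log(𝔮_M) = log(𝔮_{L_mod})`» — of which
Joshi writes (p.41 l.17–18) «The following fundamental property of the Tate divisor is asserted without proof in [Mochizuki,
2021d] (no proof is given in [Tan, 2018] or [Yamashita, 2019])». PROVED from the typed base-change relation: the computation
(4.4.5)–(4.4.9) («`log w = f_{w|v}·log v`», «`Σ_{w|v} e_{w|v}·f_{w|v} = [M : L_mod]`», «`[M:ℚ] = [M:L_mod]·[L_mod:ℚ]`») is the
tree's `ADivisor.ndeg_pullback` (invariance of the normalized degree under pull-back, [IUTchIV] Def. 1.9 (i)).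
[cite: Mochizuki2012, IUTchIV Def. 1.9 (i) p. 22] -/
theorem prop444 (h : 𝔮M.IsBaseChangeOf 𝔮) : 𝔮M.logq = 𝔮.logq := by
  rw [logq, logq, 𝔮M.tateDivisor_eq_pullback 𝔮 h, ndeg_pullback]

/-- Un-normalized form, (4.4.6)–(4.4.8): `deg(𝔮_M) = [M : L_mod]·deg(𝔮_{L_mod})` (tree `ADivisor.degF_pullback`). [folklore] -/
theorem degF_tateDivisor_eq_mul (h : 𝔮M.IsBaseChangeOf 𝔮) :
    degF M 𝔮M.tateDivisor = Module.finrank Lmod M * degF Lmod 𝔮.tateDivisor := by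
  rw [𝔮M.tateDivisor_eq_pullback 𝔮 h, degF_pullback]

end BaseChange

section Tower

variable {Lmod M M' : Type*} [Field Lmod] [NumberField Lmod] [Field M] [NumberField M] [Field M'] [NumberField M']
  [Algebra Lmod M] [Algebra Lmod M']

/-- Proposition 4.4.4 for two intermediate fields `L′ ⊇ M, M′ ⊇ L_mod`: `log(𝔮_M) = log(𝔮_{M′})` (both equal `log(𝔮_{L_mod})`).
[folklore] -/
theorem logq_eq_logq_of_isBaseChangeOf (𝔮 : TateDivisorDatum Lmod) (𝔮M : TateDivisorDatum M)
    (𝔮M' : TateDivisorDatum M') (h : 𝔮M.IsBaseChangeOf 𝔮) (h' : 𝔮M'.IsBaseChangeOf 𝔮) : 𝔮M.logq = 𝔮M'.logq := by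
  rw [𝔮M.prop444 𝔮 h, 𝔮M'.prop444 𝔮 h']

end Tower

end TateDivisorDatum

/-! ## 3. §4.1.2 (6)–(9) and Lemma 4.1.4 over the tower `L_tpd → L → L′` -/

/-- **The tower of §4.1.2 (7)–(9)** (p.38 l.8–10) over genuine number fields `L_tpd → L → L′` (the field `L′` is «the number
field determined by Initial Theta Data», §4.2.1 p.39 l.17–18, [J-III] §3.3 (13)): the prime `ℓ`, the support `Supp(𝔮_{L_tpd})`
of the Tate divisor of `C_{L_tpd}` (a finite set of finite places of `L_tpd`, §4.4), and — as OPAQUE `Prop` fields, since the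
torsion points of `C` are not objects of this file — (7) «`C_L(L) ⊃ C_L[15](L̄)`», (8) «`L_mod ⊆ L_tpd = L_mod(C_{L_mod}[2](L̄))
⊆ L`», (9) «`L = L_tpd(√−1, C_{L_tpd}[3·5])`, this implies that `C_L` is extended from `C_{L_tpd}`». SIGNATURE; merge-debt:
T-06 / T-28 (the concrete torsion-field hypotheses). [claim: Joshi2024ATS4, status: disputed] -/
structure TowerDatum (Ltpd L L' : Type*) [Field Ltpd] [NumberField Ltpd] [Field L] [NumberField L]
    [Field L'] [NumberField L'] [Algebra Ltpd L] [Algebra L L'] where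
  /-- the prime `ℓ` of §4.1.2 (6) -/
  ell : ℕ
  /-- `Supp(𝔮_{L_tpd})` = `V^{odd,ss}_{L_tpd}`, the support of the Tate divisor of `C_{L_tpd}` (the field `TateDivisorDatum.V`
  of its §4.4 datum) -/
  suppq : Finset (HeightOneSpectrum (𝓞 Ltpd))
  /-- §4.1.2 (7): `C_L(L) ⊇ C_L[15](L̄)` (opaque) -/
  torsion15 : Prop
  /-- §4.1.2 (8): `L_tpd = L_mod(C_{L_mod}[2](L̄))` (opaque) -/
  ltpd_eq_twoTorsionField : Prop
  /-- §4.1.2 (9): `L = L_tpd(√−1, C_{L_tpd}[3·5])` (opaque) -/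
  l_eq_torsionField : Prop

namespace TowerDatum

variable {Ltpd L L' : Type*} [Field Ltpd] [NumberField Ltpd] [Field L] [NumberField L] [Field L'] [NumberField L']
  [Algebra Ltpd L] [Algebra L L'] (𝓣 : TowerDatum Ltpd L L')

/-- §4.1.2 (6)–(9) as one hypothesis, with the CONCRETE consequence of (9) that `√−1 ∈ L`.
[claim: Joshi2024ATS4, status: disputed] -/
def Hyps : Prop := (𝓣.ell.Prime ∧ 5 ≤ 𝓣.ell) ∧ 𝓣.torsion15 ∧ 𝓣.ltpd_eq_twoTorsionField ∧ 𝓣.l_eq_torsionField ∧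
  ∃ i : L, i * i = -1

/-- **Lemma 4.1.4 (1)** (p.38 l.32–35): «The extension `L/L_tpd` is unramified outside `{v ∈ V_{L_tpd} : v divides 2·3·5·ℓ}
∪ Supp(𝔮_{L_tpd})` and `L/L_tpd` is tamely ramified outside `{v ∈ V_{L_tpd} : v divides 2·3·5}`»; printed proof: «immediate from
Proposition 4.1.1». Named `Prop`, never asserted. [claim: Joshi2024ATS4, status: disputed] -/
@[claim "Joshi2024ATS4" "disputed"]
def Lem414_1 : Prop :=
  UnramifiedOutside Ltpd L ({v | residueChar Ltpd v ∣ 2 * 3 * 5 * 𝓣.ell} ∪ ↑𝓣.suppq) ∧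
    TamelyRamifiedOutside Ltpd L {v | residueChar Ltpd v ∣ 2 * 3 * 5}

/-- **Lemma 4.1.4 (2)** (p.38 l.36–39): «The extension `L′/L` is unramified outside `{v ∈ V_{L_tpd} : v divides 2·ℓ} ∪
Supp(𝔮_{L_tpd})` and `L′/L` is tamely ramified outside `{v ∈ V_{L_tpd} : v divides 2·ℓ}`». The printed exceptional sets are
subsets of `V_{L_tpd}`; typed (our reading, flagged PARAPHRASE for the referee) as the places of `L` lying over them.
Named `Prop`, never asserted. [claim: Joshi2024ATS4, status: disputed] -/
@[claim "Joshi2024ATS4" "disputed"]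
def Lem414_2 : Prop :=
  UnramifiedOutside L L' {v | residueChar L v ∣ 2 * 𝓣.ell ∨ finBelow Ltpd L v ∈ 𝓣.suppq} ∧
    TamelyRamifiedOutside L L' {v | residueChar L v ∣ 2 * 𝓣.ell}

/-- **Lemma 4.1.4** = (1) ∧ (2). [claim: Joshi2024ATS4, status: disputed] -/
@[claim "Joshi2024ATS4" "disputed"]
def Lem414 : Prop := 𝓣.Lem414_1 ∧ 𝓣.Lem414_2

end TowerDatum

end Summit.ABC.IUTFork.Joshi.ATS4
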